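import Mathlib
import HarnessLib
import Summits.CriticalPhenomena.PercolationContinuityZ3.Theses.PercTreeValue
import Literature.Probability.Percolation.TwoPointFunction
import Literature.Probability.Percolation.Crossings

/-!
# Sketch — crux-ideate stmt-CriticalPhenomena-7798 (TetrahedronDisjointCoexistence), round 1, ideator 1

First lemmas / transfer targets of the two idea cards, stated over existing declarations.
Card 1 `ceiling-decoupling-hhc`: target ⊇ A_h ∩ B_h with A_h, B_h on disjoint edge sets;
TDC ⇐ HalfHeightConfinement (one-cluster statement).
Card 2 `closed-shell-barrier-dichotomy`: target ⊇ {0↔a in R} ∩ {annulus R'∖R has no open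
crossing} ∩ {b↔c in W}; TDC ⇐ Barrier ∧ SlabRestrictionCore ∧ SlabRestrictionHalf.
-/

namespace Summit.CriticalPhenomena.PercolationContinuityZ3.Cruxes.TetrahedronDisjointCoexistence.Sketch

open Literature.Probability.Percolation Literature.Probability.LatticeModels MeasureTheory

noncomputable section

/-- `P_{p_c}` on `ℤ³`. -/
abbrev Pc : Measure (BondConfig (Site 3)) := bondPercolation (zdGraph 3) (criticalProbI 3)
/-- `a_r = (r,r,0)`. -/
abbrev aPt (r : ℕ) : Site 3 := ![(r : ℤ), (r : ℤ), 0]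
/-- `b_r = (r,0,r)`. -/
abbrev bPt (r : ℕ) : Site 3 := ![(r : ℤ), 0, (r : ℤ)]
/-- `c_r = (0,r,r)`. -/
abbrev cPt (r : ℕ) : Site 3 := ![0, (r : ℤ), (r : ℤ)]

/-- The crux event `{0 ↔ a_r} ∩ {b_r ↔ c_r} ∩ {0 ↮ b_r}`. -/
def target (r : ℕ) : Set (BondConfig (Site 3)) :=
  openConn 0 (aPt r) ∩ openConn (bPt r) (cPt r) ∩ (openConn (0 : Site 3) (bPt r))ᶜ

/-- Sanity: `target` is literally the event of the route decl. -/
theorem tdc_iff :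
    Theses.PercTreeValue.TetrahedronDisjointCoexistence ↔
      ∃ δ : ℝ, 0 < δ ∧ ∃ r₀ : ℕ, ∀ r : ℕ, r₀ ≤ r →
        δ * tau 3 (criticalProbI 3) 0 (aPt r) * tau 3 (criticalProbI 3) (bPt r) (cPt r) ≤ Pc.real (target r) :=
  Iff.rfl

/-! ## Card 1: ceiling decoupling ⇒ half-height confinement suffices -/

/-- `A_h = {0 ↔ a_r} ∩ {C(0) ⊆ {x₂ ≤ h}}` — determined by the edges touching `{x₂ ≤ h}`. -/
def confined (r : ℕ) (h : ℤ) : Set (BondConfig (Site 3)) :=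
  openConn 0 (aPt r) ∩ {ω | openCluster ω 0 ⊆ {x : Site 3 | x 2 ≤ h}}

/-- `B_h = {b_r ↔ c_r in {x₂ ≥ h+1}}` — determined by the edges inside `{x₂ ≥ h+1}`. -/
def upperConn (r : ℕ) (h : ℤ) : Set (BondConfig (Site 3)) :=
  openConnIn {x : Site 3 | h + 1 ≤ x 2} (bPt r) (cPt r)

/-- FIRST LEMMA (card 1): `P(A_h) · P(B_h) ≤ P(target)` for every `p, r, h` — `A_h ∩ B_h ⊆ target`
(`C(0) ⊆ {x₂ ≤ h} ∌ b_r`) and `A_h ⟂ B_h` (`bondPercolation_real_inter_of_disjoint` on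
`edgesTouching {x₂ ≤ h}` vs `{x₂ ≥ h+1}.sym2`, `disjoint_edgesTouching_compl_sym2`). -/
def CeilingDecoupling : Prop :=
  ∀ (p : unitInterval) (r : ℕ) (h : ℤ),
    (bondPercolation (zdGraph 3) p).real (confined r h) *
        (bondPercolation (zdGraph 3) p).real (upperConn r h) ≤
      (bondPercolation (zdGraph 3) p).real (target r)

/-- MIRROR (card 1): the lattice isometry `σ(x) = (x₀, r - x₁, r - x₂)` (`zdSignedPermIso 1 (1,-1,-1)`
then `zdShiftIso (0,r,r)`) maps `(0, a_r) ↦ (c_r, b_r)` and `{x₂ ≤ h} ↦ {x₂ ≥ r - h} ⊆ {x₂ ≥ h+1}`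
when `2h + 1 ≤ r`, so `P(A_h) ≤ P(B_h)`; and `τ(b_r,c_r) = τ(0,a_r)`. -/
def CeilingMirror : Prop :=
  ∀ (p : unitInterval) (r : ℕ) (h : ℤ), 2 * h + 1 ≤ r →
    (bondPercolation (zdGraph 3) p).real (confined r h) ≤
        (bondPercolation (zdGraph 3) p).real (upperConn r h) ∧
      tau 3 p (bPt r) (cPt r) = tau 3 p 0 (aPt r)

/-- TRANSFER TARGET C⁺ (card 1): **half-height confinement at constant cost** — conditional on
`0 ↔ a_r`, the whole cluster of `0` stays strictly below height `r/2` with probability `≥ c`. -/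
def HalfHeightConfinement : Prop :=
  ∃ c : ℝ, 0 < c ∧ ∃ r₀ : ℕ, ∀ r : ℕ, r₀ ≤ r →
    c * tau 3 (criticalProbI 3) 0 (aPt r) ≤ Pc.real (confined r (((r : ℤ) - 1) / 2))

/-- Composition (card 1): `CeilingDecoupling → CeilingMirror → HalfHeightConfinement → TDC`
with `δ = c²` (pure real-number bookkeeping). -/
theorem tdc_of_halfHeightConfinement (h1 : CeilingDecoupling) (h2 : CeilingMirror)
    (h3 : HalfHeightConfinement) : Theses.PercTreeValue.TetrahedronDisjointCoexistence := by
  obtain ⟨c, hc, r₀, hr⟩ := h3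
  refine ⟨c ^ 2, by positivity, r₀, fun r hr' => ?_⟩
  have hA := hr r hr'
  have hh : 2 * (((r : ℤ) - 1) / 2) + 1 ≤ (r : ℤ) := by omega
  obtain ⟨hM, hτ⟩ := h2 (criticalProbI 3) r (((r : ℤ) - 1) / 2) hh
  have hD := h1 (criticalProbI 3) r (((r : ℤ) - 1) / 2)
  have hτ0 : 0 ≤ tau 3 (criticalProbI 3) 0 (aPt r) := tau_nonneg _ _ _
  have hPA : 0 ≤ (bondPercolation (zdGraph 3) (criticalProbI 3)).real (confined r (((r : ℤ) - 1) / 2)) :=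
    measureReal_nonneg
  rw [hτ]
  have hcτ : 0 ≤ c * tau 3 (criticalProbI 3) 0 (aPt r) := by positivity
  calc c ^ 2 * tau 3 (criticalProbI 3) 0 (aPt r) * tau 3 (criticalProbI 3) 0 (aPt r)
      = (c * tau 3 (criticalProbI 3) 0 (aPt r)) * (c * tau 3 (criticalProbI 3) 0 (aPt r)) := by ring
    _ ≤ (bondPercolation (zdGraph 3) (criticalProbI 3)).real (confined r (((r : ℤ) - 1) / 2)) *
          (bondPercolation (zdGraph 3) (criticalProbI 3)).real (confined r (((r : ℤ) - 1) / 2)) :=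
        mul_le_mul hA hA hcτ hPA
    _ ≤ (bondPercolation (zdGraph 3) (criticalProbI 3)).real (confined r (((r : ℤ) - 1) / 2)) *
          (bondPercolation (zdGraph 3) (criticalProbI 3)).real (upperConn r (((r : ℤ) - 1) / 2)) :=
        mul_le_mul_of_nonneg_left hM hPA
    _ ≤ Pc.real (target r) := hD

/-! ## Card 2: closed-shell decoupling; Barrier (van den Berg–van Engelenburg horn) + slab restriction -/

/-- Inner layer of the annulus `R' ∖ R`: its vertices adjacent to `R`. -/
def innerLayer (R R' : Set (Site 3)) : Set (Site 3) :=
  {x | x ∈ R' \ R ∧ ∃ y ∈ R, (zdGraph 3).Adj x y}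

/-- Outer layer of the annulus `R' ∖ R`: its vertices adjacent to `R'ᶜ`. -/
def outerLayer (R R' : Set (Site 3)) : Set (Site 3) :=
  {x | x ∈ R' \ R ∧ ∃ y ∉ R', (zdGraph 3).Adj x y}

/-- CLOSED SHELL: no open path of the annulus `R' ∖ R` joins its inner layer to its outer layer
(a DECREASING event, determined by the edges inside `R' ∖ R`). -/
def shellClosed (R R' : Set (Site 3)) : Set (BondConfig (Site 3)) :=
  (openCrossing (R' \ R) (innerLayer R R') (outerLayer R R'))ᶜ

/-- FIRST LEMMA (card 2): three events on pairwise disjoint edge sets (`R.sym2`, `(R'∖R).sym2`,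
`W.sym2`); on their intersection `C(0) ⊆ R' ∌ b_r` (last-exit decomposition of an escaping path,
which needs `N(R) ⊆ R'`), so it lies in `target`; independence gives the product. -/
def ShellDecoupling : Prop :=
  ∀ (p : unitInterval) (r : ℕ) (R R' W : Set (Site 3)),
    R ⊆ R' → (∀ x ∈ R, ∀ y, (zdGraph 3).Adj x y → y ∈ R') → Disjoint R' W → (0 : Site 3) ∈ R →
    (bondPercolation (zdGraph 3) p).real (openConnIn R 0 (aPt r)) *
        (bondPercolation (zdGraph 3) p).real (shellClosed R R') *
        (bondPercolation (zdGraph 3) p).real (openConnIn W (bPt r) (cPt r)) ≤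
      (bondPercolation (zdGraph 3) p).real (target r)

/-- The flat box `[0, Mk]² × [0, k]`. -/
def flatBox (k M : ℕ) : Set (Site 3) :=
  {x | 0 ≤ x 0 ∧ x 0 ≤ ((M * k : ℕ) : ℤ) ∧ 0 ≤ x 1 ∧ x 1 ≤ ((M * k : ℕ) : ℤ) ∧ 0 ≤ x 2 ∧ x 2 ≤ (k : ℤ)}

/-- Thin-direction open crossing `V(k, Mk)` of the flat box (van den Berg–van Engelenburg 2022, §2). -/
def thinCrossing (k M : ℕ) : Set (BondConfig (Site 3)) :=
  openCrossing (flatBox k M) {x | x ∈ flatBox k M ∧ x 2 = 0} {x | x ∈ flatBox k M ∧ x 2 = (k : ℤ)}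

/-- BARRIER(M): at `p_c(ℤ³)` flat boxes of aspect ratio `M` are NOT crossed in the thin direction
with probability bounded away from `1` — horn (8) of vdB–vE Lemma 2.1, asserted at all scales. -/
def Barrier (M : ℕ) : Prop :=
  ∃ ε : ℝ, 0 < ε ∧ ∃ k₀ : ℕ, ∀ k : ℕ, k₀ ≤ k → Pc.real (thinCrossing k M) ≤ 1 - ε

/-- Core box around `{0, a_r}`: lateral half-width `2r`, floor `-4r`, ceiling `⌊r/3⌋`. -/
def coreBox (r : ℕ) : Set (Site 3) :=
  {x | -(2 * (r : ℤ)) ≤ x 0 ∧ x 0 ≤ 2 * r ∧ -(2 * (r : ℤ)) ≤ x 1 ∧ x 1 ≤ 2 * r ∧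
    -(4 * (r : ℤ)) ≤ x 2 ∧ x 2 ≤ (r : ℤ) / 3}

/-- Outer box = core thickened by `t_r = ⌊r/2⌋ - ⌊r/3⌋` (ceiling `⌊r/2⌋`, still below `b_r, c_r`). -/
def outerBox (r : ℕ) : Set (Site 3) :=
  {x | -(2 * (r : ℤ)) - ((r : ℤ) / 2 - (r : ℤ) / 3) ≤ x 0 ∧ x 0 ≤ 2 * r + ((r : ℤ) / 2 - (r : ℤ) / 3) ∧
    -(2 * (r : ℤ)) - ((r : ℤ) / 2 - (r : ℤ) / 3) ≤ x 1 ∧ x 1 ≤ 2 * r + ((r : ℤ) / 2 - (r : ℤ) / 3) ∧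
    -(4 * (r : ℤ)) - ((r : ℤ) / 2 - (r : ℤ) / 3) ≤ x 2 ∧ x 2 ≤ (r : ℤ) / 2}

/-- Upper region for `b_r ↔ c_r`: `{x₂ ≥ ⌊r/2⌋ + 1}` (depth `≈ r/2` below `b_r, c_r`). -/
def upperHalf (r : ℕ) : Set (Site 3) := {x | (r : ℤ) / 2 + 1 ≤ x 2}

/-- SHELL FROM BARRIER: the annulus `outerBox r ∖ coreBox r` is the union of six slab boxes of
thickness `t_r` and lateral size `≤ 30 t_r`; no thin crossing of any of them ⇒ `shellClosed`
(Kesten's annulus decomposition), and the six decreasing events glue by Harris–FKG. -/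
def ShellFromBarrier : Prop :=
  Barrier 30 → ∃ ε : ℝ, 0 < ε ∧ ∃ r₀ : ℕ, ∀ r : ℕ, r₀ ≤ r → ε ≤ Pc.real (shellClosed (coreBox r) (outerBox r))

/-- SLAB RESTRICTION, core form: connecting `0 ↔ a_r` inside the core box costs a constant. -/
def SlabRestrictionCore : Prop :=
  ∃ c : ℝ, 0 < c ∧ ∃ r₀ : ℕ, ∀ r : ℕ, r₀ ≤ r →
    c * tau 3 (criticalProbI 3) 0 (aPt r) ≤ Pc.real (openConnIn (coreBox r) 0 (aPt r))

/-- SLAB RESTRICTION, half-space form: connecting `b_r ↔ c_r` inside `{x₂ > r/2}` costs a constant. -/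
def SlabRestrictionHalf : Prop :=
  ∃ c : ℝ, 0 < c ∧ ∃ r₀ : ℕ, ∀ r : ℕ, r₀ ≤ r →
    c * tau 3 (criticalProbI 3) (bPt r) (cPt r) ≤ Pc.real (openConnIn (upperHalf r) (bPt r) (cPt r))

/-- Composition (card 2): shell decoupling + shell from Barrier + the two restriction costs ⇒ TDC,
`δ = c_core · ε · c_half` (geometry: `coreBox ⊆ outerBox`, `N(coreBox) ⊆ outerBox` for `r ≥ 12`,
`outerBox ⟂ upperHalf`, `0 ∈ coreBox`). -/
def CardTwoAssembly : Prop :=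
  ShellDecoupling → ShellFromBarrier → Barrier 30 → SlabRestrictionCore → SlabRestrictionHalf →
    Theses.PercTreeValue.TetrahedronDisjointCoexistence

end

end Summit.CriticalPhenomena.PercolationContinuityZ3.Cruxes.TetrahedronDisjointCoexistence.Sketch
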